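import Summits.QuantumAdvantage.QuantumAdvantage.Theorems.CharDialJBlockTop
import Summits.QuantumAdvantage.QuantumAdvantage.Theorems.CharDialSupportBound
import HarnessLib

/-!
# TopZeroBounded — a set of relevant coordinates with identically zero top layer is bounded (PLAN §11.2, kernel)

(decomp-qadv-lens-6 g8.)  For a Boolean `f` with `deg_p f ≤ p − 1`: if every coordinate of `X` is relevant and every
top Möbius coefficient `μ_T(f)`, `T ⊆ X`, `|T| = p − 1`, vanishes, then `|X| ≤ 2^{p−1}·J₁(p) + p` where `J₁(p)` is the
junta bound of law 2 at degree `p − 2`.  Proof: every slice of `f` over `X` (outside frozen) has degree `≤ p − 2`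
(`moeb_restr_eq_of_card_eq` + `moeb_eq_zero_of_indep`), hence is a `J₁`-junta (`junta_of_hasDegF_subChar`); for
`a ∈ X` the outside-function `E_a(v) = 1_f(w_a ⊕ e_a, v) − 1_f(w_a, v)` has degree `≤ p − 1` and is non-zero, so it is
supported on `≥ 2^{n−(p−1)}` points (`card_support_ge_of_mem_lowDeg`), and wherever `E_a(v) ≠ 0` the coordinate `a`
belongs to the junta of the slice at `v`; double counting gives `|X|·2^{n−(p−1)} ≤ 2^n·J₁`.
This discharges `Law25.stub_topZero_bounded` of the skeleton `sigs/Law25p5.skeleton.lean`.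
-/

namespace Summit.QuantumAdvantage.AdviceFreeQNC0

namespace SubLog

variable {n : ℕ}

/-- CharDial sub-characteristic helper `merge_self` (lens-6 g8 LAND package; see the module docstring). -/
theorem merge_self (S : Finset (Fin n)) (u : Fin n → Bool) : merge S u u = u := by
  funext j
  unfold merge
  split_ifs <;> rfl

/-- CharDial sub-characteristic helper `merge_update_of_mem` (lens-6 g8 LAND package; see the module docstring). -/
theorem merge_update_of_mem {S : Finset (Fin n)} {i : Fin n} (hi : i ∈ S) (u v : Fin n → Bool) (b : Bool) :
    merge S (Function.update u i b) v = Function.update (merge S u v) i b := by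
  funext j
  by_cases hj : j = i
  · subst hj
    simp [merge, hi]
  · rw [Function.update_of_ne hj]
    unfold merge
    rw [Function.update_of_ne hj]

/-- CharDial sub-characteristic helper `merge_update_of_not_mem` (lens-6 g8 LAND package; see the module docstring). -/
theorem merge_update_of_not_mem {S : Finset (Fin n)} {i : Fin n} (hi : i ∉ S) (u v : Fin n → Bool) (b : Bool) :
    merge S (Function.update u i b) v = merge S u v := by
  funext j
  unfold merge
  by_cases hj : j ∈ S
  · rw [if_pos hj, if_pos hj, Function.update_of_ne (ne_of_mem_of_not_mem hj hi)]
  · rw [if_neg hj, if_neg hj]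

/-- CharDial sub-characteristic helper `merge_compl_comm` (lens-6 g8 LAND package; see the module docstring). -/
theorem merge_compl_comm (S : Finset (Fin n)) (u v : Fin n → Bool) : merge Sᶜ v u = merge S u v := by
  funext j
  unfold merge
  by_cases hj : j ∈ S
  · rw [if_pos hj, if_neg (fun h => Finset.mem_compl.1 h hj)]
  · rw [if_neg hj, if_pos (Finset.mem_compl.2 hj)]

end SubLog

namespace SubChar

open Finset
open Literature.Computability.MetaComplexity Literature.Computability.MetaComplexity.Smolensky

variable {n : ℕ}

/-- **PLAN §11.2 (kernel)**: relevant coordinates carrying an identically zero top layer are bounded in number. -/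
theorem topZero_bounded (p : ℕ) [hp : Fact p.Prime] :
    ∃ M₀ : ℕ, ∀ (n : ℕ) (f : (Fin n → Bool) → Bool) (X : Finset (Fin n)), HasDegF p f (p - 1) →
      (∀ i ∈ X, ∃ (u : Fin n → Bool) (b : Bool), f (Function.update u i b) ≠ f u) →
      (∀ T ⊆ X, T.card = p - 1 → SubLog.moeb (SubLog.indR (ZMod p) f) T = 0) → X.card ≤ M₀ := by
  classical
  have hp2 : 2 ≤ p := hp.out.two_le
  obtain ⟨J₁, hJ₁⟩ := junta_of_hasDegF_subChar p (p - 2) (by omega)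
  refine ⟨2 ^ (p - 1) * J₁ + p, fun n f X hf hrel htop => ?_⟩
  by_cases hn : p - 1 ≤ n
  swap
  · have hX : X.card ≤ n := by simpa using Finset.card_le_univ X
    omega
  set g : CubeFn (ZMod p) n := SubLog.indR (ZMod p) f with hgdef
  have hg : g ∈ lowDeg (ZMod p) n (p - 1) := (SubLog.hasDegF_iff_indR p f (p - 1)).1 hf
  -- (1) every slice over X has degree ≤ p − 2, hence is a J₁-junta
  have hslice : ∀ v : Fin n → Bool, HasDegF p (fun u => f (SubLog.merge X u v)) (p - 2) := by
    intro v
    rw [SubLog.hasDegF_iff_indR]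
    have hres : SubLog.indR (ZMod p) (fun u => f (SubLog.merge X u v)) = SubLog.restr X v g := rfl
    rw [hres]
    apply SubLog.mem_lowDeg_of_moeb_eq_zero
    intro S hS
    by_cases hS' : p - 1 < S.card
    · exact SubLog.moeb_eq_zero_of_mem_lowDeg (SubLog.restr_mem_lowDeg X v hg) hS'
    · have hSc : S.card = p - 1 := by omega
      by_cases hSX : S ⊆ X
      · rw [SubLog.moeb_restr_eq_of_card_eq hg hSX hSc v]
        exact htop S hSX hSc
      · obtain ⟨i, hiS, hiX⟩ := Finset.not_subset.1 hSX
        refine SubLog.moeb_eq_zero_of_indep (i := i) (fun u b => ?_) hiS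
        show g (SubLog.merge X (Function.update u i b) v) = g (SubLog.merge X u v)
        rw [SubLog.merge_update_of_not_mem hiX]
  choose Jv hJv_card hJv using fun v => hJ₁ n (fun u => f (SubLog.merge X u v)) (hslice v)
  -- (2) witnesses of relevance, extended to all coordinates by a default
  have hrel' : ∀ i : Fin n, ∃ (u : Fin n → Bool) (b : Bool), i ∈ X → f (Function.update u i b) ≠ f u := by
    intro i
    by_cases hi : i ∈ X
    · obtain ⟨u, b, h⟩ := hrel i hi
      exact ⟨u, b, fun _ => h⟩
    · exact ⟨fun _ => false, false, fun h => absurd h hi⟩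
  choose w b hwb using hrel'
  -- (3) the outside-functions E_a
  set E : Fin n → CubeFn (ZMod p) n := fun a v =>
    g (SubLog.merge X (Function.update (w a) a (b a)) v) - g (SubLog.merge X (w a) v) with hEdef
  have hEdeg : ∀ a, E a ∈ lowDeg (ZMod p) n (p - 1) := by
    intro a
    have h1 : ∀ u : Fin n → Bool, (fun v => g (SubLog.merge X u v)) = SubLog.restr Xᶜ u g := by
      intro u
      funext v
      show g (SubLog.merge X u v) = g (SubLog.merge Xᶜ v u)
      rw [SubLog.merge_compl_comm]
    have hE' : E a = SubLog.restr Xᶜ (Function.update (w a) a (b a)) g - SubLog.restr Xᶜ (w a) g := by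
      rw [← h1, ← h1]
      funext v
      rfl
    rw [hE']
    exact Submodule.sub_mem _ (SubLog.restr_mem_lowDeg _ _ hg) (SubLog.restr_mem_lowDeg _ _ hg)
  -- E_a v ≠ 0 ⇒ the slice at v distinguishes w_a ⊕ e_a from w_a ⇒ a ∈ Jv v
  have hkey : ∀ a ∈ X, ∀ v, E a v ≠ 0 → a ∈ Jv v := by
    intro a ha v hv
    by_contra haJ
    apply hv
    show g (SubLog.merge X (Function.update (w a) a (b a)) v) - g (SubLog.merge X (w a) v) = 0
    have hfeq : f (SubLog.merge X (Function.update (w a) a (b a)) v) = f (SubLog.merge X (w a) v) :=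
      hJv v (Function.update (w a) a (b a)) (w a) (fun j hj => Function.update_of_ne (ne_of_mem_of_not_mem hj haJ) _ _)
    rw [hgdef]
    unfold SubLog.indR
    rw [hfeq, sub_self]
  -- E_a ≠ 0 (it is ±1 at v = w_a)
  have hEne : ∀ a ∈ X, E a ≠ 0 := by
    intro a ha hE0
    have h0 : E a (w a) = 0 := by rw [hE0]; rfl
    apply hwb a ha
    have h1 : g (Function.update (w a) a (b a)) - g (w a) = 0 := by
      have := h0
      simp only [hEdef] at this
      rwa [SubLog.merge_update_of_mem ha, SubLog.merge_self] at this
    rw [hgdef] at h1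
    unfold SubLog.indR at h1
    cases hfa : f (Function.update (w a) a (b a)) <;> cases hfw : f (w a)
    · rfl
    · rw [hfa, hfw] at h1; simp at h1
    · rw [hfa, hfw] at h1; simp at h1
    · rfl
  -- (4) support bound and double counting
  have hsupp : ∀ a ∈ X, 2 ^ (n - (p - 1)) ≤ (Finset.univ.filter fun v => E a v ≠ 0).card :=
    fun a ha => SubLog.card_support_ge_of_mem_lowDeg (hEdeg a) (hEne a ha)
  have hcount : ∑ a ∈ X, (Finset.univ.filter fun v => E a v ≠ 0).card ≤ 2 ^ n * J₁ := by
    have h1 : ∑ a ∈ X, (Finset.univ.filter fun v => E a v ≠ 0).card =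
        ∑ v : Fin n → Bool, ∑ a ∈ X, (if E a v ≠ 0 then 1 else 0) := by
      rw [Finset.sum_comm]
      exact Finset.sum_congr rfl fun a _ => Finset.card_filter _ _
    rw [h1]
    have h2 : ∀ v : Fin n → Bool, ∑ a ∈ X, (if E a v ≠ 0 then 1 else 0) ≤ J₁ := by
      intro v
      rw [← Finset.card_filter]
      exact le_trans (Finset.card_le_card fun a ha => hkey a (Finset.mem_filter.1 ha).1 v (Finset.mem_filter.1 ha).2)
        (hJv_card v)
    calc ∑ v : Fin n → Bool, ∑ a ∈ X, (if E a v ≠ 0 then 1 else 0) ≤ ∑ v : Fin n → Bool, J₁ :=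
          Finset.sum_le_sum fun v _ => h2 v
      _ = 2 ^ n * J₁ := by
          rw [Finset.sum_const, smul_eq_mul, Finset.card_univ, Fintype.card_fun, Fintype.card_bool,
            Fintype.card_fin]
  have hlow : X.card * 2 ^ (n - (p - 1)) ≤ ∑ a ∈ X, (Finset.univ.filter fun v => E a v ≠ 0).card := by
    rw [← smul_eq_mul, ← Finset.sum_const]
    exact Finset.sum_le_sum fun a ha => hsupp a ha
  have hpow : 2 ^ n = 2 ^ (p - 1) * 2 ^ (n - (p - 1)) := by
    rw [← pow_add, Nat.add_sub_cancel' hn]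
  have hmain : X.card * 2 ^ (n - (p - 1)) ≤ (2 ^ (p - 1) * J₁) * 2 ^ (n - (p - 1)) := by
    calc X.card * 2 ^ (n - (p - 1)) ≤ 2 ^ n * J₁ := hlow.trans hcount
      _ = (2 ^ (p - 1) * J₁) * 2 ^ (n - (p - 1)) := by rw [hpow]; ring
  have hXle : X.card ≤ 2 ^ (p - 1) * J₁ := Nat.le_of_mul_le_mul_right hmain (by positivity)
  omega

end SubChar

end Summit.QuantumAdvantage.AdviceFreeQNC0
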